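import Summits.Ventures.Crystal3D.Theorems.StickyWulffConstantTextureBuildRiserBoxRow
import Summits.Ventures.Crystal3D.Theorems.StickyWulffConstantTextureBuildRiserCurtainSum
import HarnessLib

/-!
# The RISER PACKAGE (B6): `RiserPackage₇` HOLDS
# (lane T, crux `TextureLiminfV5`, stmt-Ventures-23912; design memo HOME/wulff-p2/g21/B6-DESIGN-g21.md; statement `RiserPackage₇` of '…TextureBuildMeshV7')

HONEST FRAMING. Venture `Summits/Ventures/Crystal3D` (cell `crystal3d-full`), route `route-Ventures-StickyWulffConstant`, helper `--supports` the
law-v5 crux `TextureLiminfV5` (stmt-Ventures-23912).  Standard axioms; no mesh constructed; F-C1 not moved — this discharges the riser-package leg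
`RiserPackage₇` of '…TextureBuildMeshV7' (`tb_energy_of_riserPackage₇ : BarlowFreeCertificateCover → RiserPackage₇ → <stub_TB_energy over Mesh₇>`),
leaving T0 (`BarlowFreeCertificateCover`) as the only named debt of `stub_TB_energy`.

* **`riserPackage₇_holds : RiserPackage₇`** — witness `μ.toMesh₅.riserInput ct τ` (extra data = the hexagon-prism planes of the occupied riser `f`-sites,
  box grain = the claim rule); `BoxRow` by '…RiserBoxRow' `riserInput_boxRow`, the curtain count by '…RiserCurtainSum' `riserInput_curtain`;
* `stub_riserPackageV7` — the registered stub name (TexShadow v8.17+); `tb_energy_of_T0` — hence `stub_TB_energy` (over `Mesh₇`) from T0 alone; `textureBuildR₇R_of_T0` — the v8.17 glue with the riser package discharged.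
-/

noncomputable section

open scoped BigOperators InnerProductSpace

namespace Summit.Ventures.Crystal3D.Cruxes.TextureLiminf.TexShadow

open Summit.Ventures.Crystal3D Summit.Ventures.Crystal3D.Theorems Set

/-- **THE RISER PACKAGE HOLDS.** -/
theorem riserPackage₇_holds : RiserPackage₇ := by
  intro C R₀ N x rc δ μ ct τ _hR₀ hτ
  exact ⟨μ.toMesh₅.riserExtra, μ.toMesh₅.riserExtra_unit, μ.toMesh₅.riserGrain, μ.toMesh₅.riserInput_boxRow ct τ hτ,
    μ.riserInput_curtain ct τ⟩

/-- **The registered stub of lane T (TexShadow v8.17+, crux `TextureLiminfV5`, stmt-Ventures-23912): `stub_riserPackageV7 : RiserPackage₇`.** -/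
theorem stub_riserPackageV7 : RiserPackage₇ := riserPackage₇_holds

/-- **`stub_TB_energy` over `Mesh₇` from T0 alone.** -/
theorem tb_energy_of_T0 (hT0 : BarlowFreeCertificateCover) :
    PolytopeCalculus → BarlowFreeCertificate →
      ∀ (C R₀ : ℝ), 1 ≤ R₀ → ∀ (N : ℕ) (x : Fin N → E3) (δ : ℝ) (rc : RiseredCover C R₀ N x) (μ : Mesh₇ rc δ),
        ∃ (n : ℕ) (G : Fin n → Set E3) (A : Fin n → (E3 ≃ₗᵢ[ℝ] E3)) (c : Fin n → Fin n → ℝ) (m : Fin n → Fin n → E3),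
          IsTexture (13 / 25) (1 / 2) n G A c m ∧ (1 - δ) * (N : ℝ) ≤ Real.sqrt 2 * vol n G ∧
          energy n G A c m ≤ rc.tentBudget + rc.chargeSum + rc.riserSum + μ.gapCost :=
  tb_energy_of_riserPackage₇ hT0 riserPackage₇_holds

/-- **THE TB SUB-LINE BY NAME over v7, riser package discharged**: TB-cover v7 + T0 ⇒ `ShadowTheoremSatV5` (given the three line-level hypotheses). -/
theorem textureBuildR₇R_of_T0 {Adh : Prop}
    (hcover : BarlowResolution → Adh →
      ∀ C R₀ : ℝ, 1 ≤ R₀ → ∀ K δ θ : ℝ, 0 < δ → 0 < θ → ∃ N₀ : ℕ, ∀ N : ℕ, N₀ ≤ N → ∀ x : Fin N → E3, IsUnitPacking x →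
        IsSaturated x → 6 * (N : ℝ) - (numContacts x : ℝ) ≤ K * (N : ℝ) ^ ((2 : ℝ) / 3) →
        ∃ (rc : RiseredCover C R₀ N x) (μ : Mesh₇ rc δ),
          rc.tilingLoss₂ + rc.rimSum + μ.gapCost ≤ θ * (N : ℝ) ^ ((2 : ℝ) / 3) + rc.unownedSlack₃)
    (hT0 : BarlowFreeCertificateCover) :
    BarlowResolution → Adh → BilayerWallV5 → PolytopeCalculus → BarlowFreeCertificate → ShadowTheoremSatV5 :=
  textureBuildR₇R_of_riserPackage hcover hT0 riserPackage₇_holds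

end Summit.Ventures.Crystal3D.Cruxes.TextureLiminf.TexShadow

end
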